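import Mathlib
import HarnessLib
import Summits.ValiantsHypothesis.ValiantsHypothesis.Theorems.LacunarySymmetroidMatrixDescartesCensusCertificates
import Summits.ValiantsHypothesis.ValiantsHypothesis.Theorems.LacunarySymmetroidMatrixDescartesOsculationLawTwoKPencil

/-!
# ValiantsHypothesis / LacunarySymmetroid — crux `MatrixDescartes` (stmt-ValiantsHypothesis-18050, V1),
# line «osculation-law», rung O3: rank-four PENCIL BOOKKEEPING on `Fin 4 ⊕ Fin 0` (the `(4,0)` letter as the monic quartic in the entry polynomials)

Roster R2664 (b) / R2685 (O3 = val-sym-engine-7; this file engine-7 g5).  Companion of ✓ `…OsculationCensusRankThreePencil` (`Fin 3 ⊕ Fin 1`) and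
✓ `OsculationFourK.insertionPoly_four_zero` (the same quartic with its coefficients as subset sums `Σ_U det G[U := unit rows]`).  For a pencil
`G(t) = Σ_l t^(d l) S_l` on `Fin 4 ⊕ Fin 0`:
* `det_four_zero` — the `4 × 4` Leibniz expansion on `Fin 4 ⊕ Fin 0` (✓ `Census.det_fin_four` after `finSumFinEquiv`);
* `insertionPoly_four_zero_entries` — the insertion polynomial `det(G(X₀) + X₁·I₄)` of the line (`insertionPoly`, `blockProj` unfolded) is the
  MONIC QUARTIC `X₁⁴ + X₁³·ι(σ₁) + X₁²·ι(σ₂) + X₁·ι(σ₃) + ι(det G)` with `σ₁` = trace, `σ₂` = the six principal `2 × 2` minors, `σ₃` = the four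
  principal `3 × 3` minors, written in the ENTRY polynomials (`ι : X ↦ X₀`); this is the shape consumed by ✓ `OsculationCuspQuartic.eval_Phi4` /
  `eval_logHessian_Phi4` / `hess_reduce_poly4`.
Used by the `(4,0)` instance of the O3 table (F5 = the `ν(4,3) = 10` extremiser at its top splitting).

HONEST FRAMING.  Calibration tooling for a line stub (`m = 4` is covered by `rungFour` / `rungAll`); the LAW `stub_osculationLaw`, the crux `MatrixDescartes`,
Conjecture B and `VP ≠ VNP` are OPEN / NOT proved; no summit statement is proved by this file.  No definitions, no named facts.
-/

-- `Summit.ValiantsHypothesis.ValiantsHypothesis.…` is the tree's mandated single-conjunct layout (Sub = Summit).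
set_option linter.dupNamespace false

noncomputable section

namespace Summit.ValiantsHypothesis.ValiantsHypothesis.Theorems.LacunarySymmetroidMatrixDescartes

open Polynomial Matrix Finset
open scoped BigOperators

namespace OsculationCensus

/-- A `4 × 4` determinant on `Fin 4 ⊕ Fin 0` (Leibniz; indices `inl 0 … inl 3`). [folklore] -/
theorem det_four_zero {R : Type*} [CommRing R] (N : Matrix (Fin 4 ⊕ Fin 0) (Fin 4 ⊕ Fin 0) R) :
    N.det =
      N (Sum.inl 0) (Sum.inl 0) * N (Sum.inl 1) (Sum.inl 1) * N (Sum.inl 2) (Sum.inl 2) * N (Sum.inl 3) (Sum.inl 3) - N (Sum.inl 0) (Sum.inl 0) * N (Sum.inl 1) (Sum.inl 1) * N (Sum.inl 2) (Sum.inl 3) * N (Sum.inl 3) (Sum.inl 2)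
      - N (Sum.inl 0) (Sum.inl 0) * N (Sum.inl 1) (Sum.inl 2) * N (Sum.inl 2) (Sum.inl 1) * N (Sum.inl 3) (Sum.inl 3) + N (Sum.inl 0) (Sum.inl 0) * N (Sum.inl 1) (Sum.inl 2) * N (Sum.inl 2) (Sum.inl 3) * N (Sum.inl 3) (Sum.inl 1)
      + N (Sum.inl 0) (Sum.inl 0) * N (Sum.inl 1) (Sum.inl 3) * N (Sum.inl 2) (Sum.inl 1) * N (Sum.inl 3) (Sum.inl 2) - N (Sum.inl 0) (Sum.inl 0) * N (Sum.inl 1) (Sum.inl 3) * N (Sum.inl 2) (Sum.inl 2) * N (Sum.inl 3) (Sum.inl 1)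
      - N (Sum.inl 0) (Sum.inl 1) * N (Sum.inl 1) (Sum.inl 0) * N (Sum.inl 2) (Sum.inl 2) * N (Sum.inl 3) (Sum.inl 3) + N (Sum.inl 0) (Sum.inl 1) * N (Sum.inl 1) (Sum.inl 0) * N (Sum.inl 2) (Sum.inl 3) * N (Sum.inl 3) (Sum.inl 2)
      + N (Sum.inl 0) (Sum.inl 1) * N (Sum.inl 1) (Sum.inl 2) * N (Sum.inl 2) (Sum.inl 0) * N (Sum.inl 3) (Sum.inl 3) - N (Sum.inl 0) (Sum.inl 1) * N (Sum.inl 1) (Sum.inl 2) * N (Sum.inl 2) (Sum.inl 3) * N (Sum.inl 3) (Sum.inl 0)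
      - N (Sum.inl 0) (Sum.inl 1) * N (Sum.inl 1) (Sum.inl 3) * N (Sum.inl 2) (Sum.inl 0) * N (Sum.inl 3) (Sum.inl 2) + N (Sum.inl 0) (Sum.inl 1) * N (Sum.inl 1) (Sum.inl 3) * N (Sum.inl 2) (Sum.inl 2) * N (Sum.inl 3) (Sum.inl 0)
      + N (Sum.inl 0) (Sum.inl 2) * N (Sum.inl 1) (Sum.inl 0) * N (Sum.inl 2) (Sum.inl 1) * N (Sum.inl 3) (Sum.inl 3) - N (Sum.inl 0) (Sum.inl 2) * N (Sum.inl 1) (Sum.inl 0) * N (Sum.inl 2) (Sum.inl 3) * N (Sum.inl 3) (Sum.inl 1)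
      - N (Sum.inl 0) (Sum.inl 2) * N (Sum.inl 1) (Sum.inl 1) * N (Sum.inl 2) (Sum.inl 0) * N (Sum.inl 3) (Sum.inl 3) + N (Sum.inl 0) (Sum.inl 2) * N (Sum.inl 1) (Sum.inl 1) * N (Sum.inl 2) (Sum.inl 3) * N (Sum.inl 3) (Sum.inl 0)
      + N (Sum.inl 0) (Sum.inl 2) * N (Sum.inl 1) (Sum.inl 3) * N (Sum.inl 2) (Sum.inl 0) * N (Sum.inl 3) (Sum.inl 1) - N (Sum.inl 0) (Sum.inl 2) * N (Sum.inl 1) (Sum.inl 3) * N (Sum.inl 2) (Sum.inl 1) * N (Sum.inl 3) (Sum.inl 0)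
      - N (Sum.inl 0) (Sum.inl 3) * N (Sum.inl 1) (Sum.inl 0) * N (Sum.inl 2) (Sum.inl 1) * N (Sum.inl 3) (Sum.inl 2) + N (Sum.inl 0) (Sum.inl 3) * N (Sum.inl 1) (Sum.inl 0) * N (Sum.inl 2) (Sum.inl 2) * N (Sum.inl 3) (Sum.inl 1)
      + N (Sum.inl 0) (Sum.inl 3) * N (Sum.inl 1) (Sum.inl 1) * N (Sum.inl 2) (Sum.inl 0) * N (Sum.inl 3) (Sum.inl 2) - N (Sum.inl 0) (Sum.inl 3) * N (Sum.inl 1) (Sum.inl 1) * N (Sum.inl 2) (Sum.inl 2) * N (Sum.inl 3) (Sum.inl 0)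
      - N (Sum.inl 0) (Sum.inl 3) * N (Sum.inl 1) (Sum.inl 2) * N (Sum.inl 2) (Sum.inl 0) * N (Sum.inl 3) (Sum.inl 1) + N (Sum.inl 0) (Sum.inl 3) * N (Sum.inl 1) (Sum.inl 2) * N (Sum.inl 2) (Sum.inl 1) * N (Sum.inl 3) (Sum.inl 0) := by
  rw [← Matrix.det_reindex_self (finSumFinEquiv (m := 4) (n := 0)) N, Census.det_fin_four]
  have h0 : (finSumFinEquiv (m := 4) (n := 0)).symm 0 = Sum.inl 0 := by decide
  have h1 : (finSumFinEquiv (m := 4) (n := 0)).symm 1 = Sum.inl 1 := by decide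
  have h2 : (finSumFinEquiv (m := 4) (n := 0)).symm 2 = Sum.inl 2 := by decide
  have h3 : (finSumFinEquiv (m := 4) (n := 0)).symm 3 = Sum.inl 3 := by decide
  simp only [Matrix.reindex_apply, Matrix.submatrix_apply, h0, h1, h2, h3]

set_option maxHeartbeats 1600000 in
/-- **At `(4,0)` the insertion polynomial is the monic quartic** `X₁⁴ + X₁³·ι(σ₁) + X₁²·ι(σ₂) + X₁·ι(σ₃) + ι(det G)` with `σ₁, σ₂, σ₃` the
trace, principal `2 × 2` and principal `3 × 3` minor sums of `G`, in the entry polynomials. [folklore] -/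
theorem insertionPoly_four_zero_entries {K : ℕ} (d : Fin K → ℕ) (S : Fin K → Matrix (Fin 4 ⊕ Fin 0) (Fin 4 ⊕ Fin 0) ℝ) :
    (∑ l, (MvPolynomial.X (0 : Fin 2) : MvPolynomial (Fin 2) ℝ) ^ d l •
              (S l).map (MvPolynomial.C : ℝ →+* MvPolynomial (Fin 2) ℝ)
            + (MvPolynomial.X (1 : Fin 2) : MvPolynomial (Fin 2) ℝ) •
              (Matrix.fromBlocks 1 0 0 0 : Matrix (Fin 4 ⊕ Fin 0) (Fin 4 ⊕ Fin 0) ℝ).map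
                (MvPolynomial.C : ℝ →+* MvPolynomial (Fin 2) ℝ)).det =
      MvPolynomial.X 1 * MvPolynomial.X 1 * MvPolynomial.X 1 * MvPolynomial.X 1
        + MvPolynomial.X 1 * MvPolynomial.X 1 * MvPolynomial.X 1 * Polynomial.aeval (MvPolynomial.X 0 : MvPolynomial (Fin 2) ℝ)
          ((∑ l, (X : ℝ[X]) ^ d l • (S l).map Polynomial.C) (Sum.inl 0) (Sum.inl 0) + (∑ l, (X : ℝ[X]) ^ d l • (S l).map Polynomial.C) (Sum.inl 1) (Sum.inl 1) + (∑ l, (X : ℝ[X]) ^ d l • (S l).map Polynomial.C) (Sum.inl 2) (Sum.inl 2) + (∑ l, (X : ℝ[X]) ^ d l • (S l).map Polynomial.C) (Sum.inl 3) (Sum.inl 3))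
        + MvPolynomial.X 1 * MvPolynomial.X 1 * Polynomial.aeval (MvPolynomial.X 0 : MvPolynomial (Fin 2) ℝ)
          (((∑ l, (X : ℝ[X]) ^ d l • (S l).map Polynomial.C) (Sum.inl 0) (Sum.inl 0) * (∑ l, (X : ℝ[X]) ^ d l • (S l).map Polynomial.C) (Sum.inl 1) (Sum.inl 1) - (∑ l, (X : ℝ[X]) ^ d l • (S l).map Polynomial.C) (Sum.inl 0) (Sum.inl 1) * (∑ l, (X : ℝ[X]) ^ d l • (S l).map Polynomial.C) (Sum.inl 1) (Sum.inl 0))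
            + ((∑ l, (X : ℝ[X]) ^ d l • (S l).map Polynomial.C) (Sum.inl 0) (Sum.inl 0) * (∑ l, (X : ℝ[X]) ^ d l • (S l).map Polynomial.C) (Sum.inl 2) (Sum.inl 2) - (∑ l, (X : ℝ[X]) ^ d l • (S l).map Polynomial.C) (Sum.inl 0) (Sum.inl 2) * (∑ l, (X : ℝ[X]) ^ d l • (S l).map Polynomial.C) (Sum.inl 2) (Sum.inl 0))
            + ((∑ l, (X : ℝ[X]) ^ d l • (S l).map Polynomial.C) (Sum.inl 0) (Sum.inl 0) * (∑ l, (X : ℝ[X]) ^ d l • (S l).map Polynomial.C) (Sum.inl 3) (Sum.inl 3) - (∑ l, (X : ℝ[X]) ^ d l • (S l).map Polynomial.C) (Sum.inl 0) (Sum.inl 3) * (∑ l, (X : ℝ[X]) ^ d l • (S l).map Polynomial.C) (Sum.inl 3) (Sum.inl 0))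
            + ((∑ l, (X : ℝ[X]) ^ d l • (S l).map Polynomial.C) (Sum.inl 1) (Sum.inl 1) * (∑ l, (X : ℝ[X]) ^ d l • (S l).map Polynomial.C) (Sum.inl 2) (Sum.inl 2) - (∑ l, (X : ℝ[X]) ^ d l • (S l).map Polynomial.C) (Sum.inl 1) (Sum.inl 2) * (∑ l, (X : ℝ[X]) ^ d l • (S l).map Polynomial.C) (Sum.inl 2) (Sum.inl 1))
            + ((∑ l, (X : ℝ[X]) ^ d l • (S l).map Polynomial.C) (Sum.inl 1) (Sum.inl 1) * (∑ l, (X : ℝ[X]) ^ d l • (S l).map Polynomial.C) (Sum.inl 3) (Sum.inl 3) - (∑ l, (X : ℝ[X]) ^ d l • (S l).map Polynomial.C) (Sum.inl 1) (Sum.inl 3) * (∑ l, (X : ℝ[X]) ^ d l • (S l).map Polynomial.C) (Sum.inl 3) (Sum.inl 1))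
            + ((∑ l, (X : ℝ[X]) ^ d l • (S l).map Polynomial.C) (Sum.inl 2) (Sum.inl 2) * (∑ l, (X : ℝ[X]) ^ d l • (S l).map Polynomial.C) (Sum.inl 3) (Sum.inl 3) - (∑ l, (X : ℝ[X]) ^ d l • (S l).map Polynomial.C) (Sum.inl 2) (Sum.inl 3) * (∑ l, (X : ℝ[X]) ^ d l • (S l).map Polynomial.C) (Sum.inl 3) (Sum.inl 2)))
        + MvPolynomial.X 1 * Polynomial.aeval (MvPolynomial.X 0 : MvPolynomial (Fin 2) ℝ)
          (((∑ l, (X : ℝ[X]) ^ d l • (S l).map Polynomial.C) (Sum.inl 1) (Sum.inl 1) * (∑ l, (X : ℝ[X]) ^ d l • (S l).map Polynomial.C) (Sum.inl 2) (Sum.inl 2) * (∑ l, (X : ℝ[X]) ^ d l • (S l).map Polynomial.C) (Sum.inl 3) (Sum.inl 3) - (∑ l, (X : ℝ[X]) ^ d l • (S l).map Polynomial.C) (Sum.inl 1) (Sum.inl 1) * (∑ l, (X : ℝ[X]) ^ d l • (S l).map Polynomial.C) (Sum.inl 2) (Sum.inl 3) * (∑ l, (X : ℝ[X]) ^ d l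 • (S l).map Polynomial.C) (Sum.inl 3) (Sum.inl 2)
            - (∑ l, (X : ℝ[X]) ^ d l • (S l).map Polynomial.C) (Sum.inl 1) (Sum.inl 2) * (∑ l, (X : ℝ[X]) ^ d l • (S l).map Polynomial.C) (Sum.inl 2) (Sum.inl 1) * (∑ l, (X : ℝ[X]) ^ d l • (S l).map Polynomial.C) (Sum.inl 3) (Sum.inl 3) + (∑ l, (X : ℝ[X]) ^ d l • (S l).map Polynomial.C) (Sum.inl 1) (Sum.inl 2) * (∑ l, (X : ℝ[X]) ^ d l • (S l).map Polynomial.C) (Sum.inl 2) (Sum.inl 3) * (∑ l, (X : ℝ[X]) ^ d l • (S l).map Polynomial.C) (Sum.inl 3) (Sum.inl 1)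
            + (∑ l, (X : ℝ[X]) ^ d l • (S l).map Polynomial.C) (Sum.inl 1) (Sum.inl 3) * (∑ l, (X : ℝ[X]) ^ d l • (S l).map Polynomial.C) (Sum.inl 2) (Sum.inl 1) * (∑ l, (X : ℝ[X]) ^ d l • (S l).map Polynomial.C) (Sum.inl 3) (Sum.inl 2) - (∑ l, (X : ℝ[X]) ^ d l • (S l).map Polynomial.C) (Sum.inl 1) (Sum.inl 3) * (∑ l, (X : ℝ[X]) ^ d l • (S l).map Polynomial.C) (Sum.inl 2) (Sum.inl 2) * (∑ l, (X : ℝ[X]) ^ d l • (S l).map Polynomial.C) (Sum.inl 3) (Sum.inl 1))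
          + ((∑ l, (X : ℝ[X]) ^ d l • (S l).map Polynomial.C) (Sum.inl 0) (Sum.inl 0) * (∑ l, (X : ℝ[X]) ^ d l • (S l).map Polynomial.C) (Sum.inl 2) (Sum.inl 2) * (∑ l, (X : ℝ[X]) ^ d l • (S l).map Polynomial.C) (Sum.inl 3) (Sum.inl 3) - (∑ l, (X : ℝ[X]) ^ d l • (S l).map Polynomial.C) (Sum.inl 0) (Sum.inl 0) * (∑ l, (X : ℝ[X]) ^ d l • (S l).map Polynomial.C) (Sum.inl 2) (Sum.inl 3) * (∑ l, (X : ℝ[X]) ^ d l • (S l).map Polynomial.C) (Sum.inl 3) (Sum.inl 2)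
            - (∑ l, (X : ℝ[X]) ^ d l • (S l).map Polynomial.C) (Sum.inl 0) (Sum.inl 2) * (∑ l, (X : ℝ[X]) ^ d l • (S l).map Polynomial.C) (Sum.inl 2) (Sum.inl 0) * (∑ l, (X : ℝ[X]) ^ d l • (S l).map Polynomial.C) (Sum.inl 3) (Sum.inl 3) + (∑ l, (X : ℝ[X]) ^ d l • (S l).map Polynomial.C) (Sum.inl 0) (Sum.inl 2) * (∑ l, (X : ℝ[X]) ^ d l • (S l).map Polynomial.C) (Sum.inl 2) (Sum.inl 3) * (∑ l, (X : ℝ[X]) ^ d l • (S l).map Polynomial.C) (Sum.inl 3) (Sum.inl 0)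
            + (∑ l, (X : ℝ[X]) ^ d l • (S l).map Polynomial.C) (Sum.inl 0) (Sum.inl 3) * (∑ l, (X : ℝ[X]) ^ d l • (S l).map Polynomial.C) (Sum.inl 2) (Sum.inl 0) * (∑ l, (X : ℝ[X]) ^ d l • (S l).map Polynomial.C) (Sum.inl 3) (Sum.inl 2) - (∑ l, (X : ℝ[X]) ^ d l • (S l).map Polynomial.C) (Sum.inl 0) (Sum.inl 3) * (∑ l, (X : ℝ[X]) ^ d l • (S l).map Polynomial.C) (Sum.inl 2) (Sum.inl 2) * (∑ l, (X : ℝ[X]) ^ d l • (S l).map Polynomial.C) (Sum.inl 3) (Sum.inl 0))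
          + ((∑ l, (X : ℝ[X]) ^ d l • (S l).map Polynomial.C) (Sum.inl 0) (Sum.inl 0) * (∑ l, (X : ℝ[X]) ^ d l • (S l).map Polynomial.C) (Sum.inl 1) (Sum.inl 1) * (∑ l, (X : ℝ[X]) ^ d l • (S l).map Polynomial.C) (Sum.inl 3) (Sum.inl 3) - (∑ l, (X : ℝ[X]) ^ d l • (S l).map Polynomial.C) (Sum.inl 0) (Sum.inl 0) * (∑ l, (X : ℝ[X]) ^ d l • (S l).map Polynomial.C) (Sum.inl 1) (Sum.inl 3) * (∑ l, (X : ℝ[X]) ^ d l • (S l).map Polynomial.C) (Sum.inl 3) (Sum.inl 1)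
            - (∑ l, (X : ℝ[X]) ^ d l • (S l).map Polynomial.C) (Sum.inl 0) (Sum.inl 1) * (∑ l, (X : ℝ[X]) ^ d l • (S l).map Polynomial.C) (Sum.inl 1) (Sum.inl 0) * (∑ l, (X : ℝ[X]) ^ d l • (S l).map Polynomial.C) (Sum.inl 3) (Sum.inl 3) + (∑ l, (X : ℝ[X]) ^ d l • (S l).map Polynomial.C) (Sum.inl 0) (Sum.inl 1) * (∑ l, (X : ℝ[X]) ^ d l • (S l).map Polynomial.C) (Sum.inl 1) (Sum.inl 3) * (∑ l, (X : ℝ[X]) ^ d l • (S l).map Polynomial.C) (Sum.inl 3) (Sum.inl 0)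
            + (∑ l, (X : ℝ[X]) ^ d l • (S l).map Polynomial.C) (Sum.inl 0) (Sum.inl 3) * (∑ l, (X : ℝ[X]) ^ d l • (S l).map Polynomial.C) (Sum.inl 1) (Sum.inl 0) * (∑ l, (X : ℝ[X]) ^ d l • (S l).map Polynomial.C) (Sum.inl 3) (Sum.inl 1) - (∑ l, (X : ℝ[X]) ^ d l • (S l).map Polynomial.C) (Sum.inl 0) (Sum.inl 3) * (∑ l, (X : ℝ[X]) ^ d l • (S l).map Polynomial.C) (Sum.inl 1) (Sum.inl 1) * (∑ l, (X : ℝ[X]) ^ d l • (S l).map Polynomial.C) (Sum.inl 3) (Sum.inl 0))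
          + ((∑ l, (X : ℝ[X]) ^ d l • (S l).map Polynomial.C) (Sum.inl 0) (Sum.inl 0) * (∑ l, (X : ℝ[X]) ^ d l • (S l).map Polynomial.C) (Sum.inl 1) (Sum.inl 1) * (∑ l, (X : ℝ[X]) ^ d l • (S l).map Polynomial.C) (Sum.inl 2) (Sum.inl 2) - (∑ l, (X : ℝ[X]) ^ d l • (S l).map Polynomial.C) (Sum.inl 0) (Sum.inl 0) * (∑ l, (X : ℝ[X]) ^ d l • (S l).map Polynomial.C) (Sum.inl 1) (Sum.inl 2) * (∑ l, (X : ℝ[X]) ^ d l • (S l).map Polynomial.C) (Sum.inl 2) (Sum.inl 1)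
            - (∑ l, (X : ℝ[X]) ^ d l • (S l).map Polynomial.C) (Sum.inl 0) (Sum.inl 1) * (∑ l, (X : ℝ[X]) ^ d l • (S l).map Polynomial.C) (Sum.inl 1) (Sum.inl 0) * (∑ l, (X : ℝ[X]) ^ d l • (S l).map Polynomial.C) (Sum.inl 2) (Sum.inl 2) + (∑ l, (X : ℝ[X]) ^ d l • (S l).map Polynomial.C) (Sum.inl 0) (Sum.inl 1) * (∑ l, (X : ℝ[X]) ^ d l • (S l).map Polynomial.C) (Sum.inl 1) (Sum.inl 2) * (∑ l, (X : ℝ[X]) ^ d l • (S l).map Polynomial.C) (Sum.inl 2) (Sum.inl 0)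
            + (∑ l, (X : ℝ[X]) ^ d l • (S l).map Polynomial.C) (Sum.inl 0) (Sum.inl 2) * (∑ l, (X : ℝ[X]) ^ d l • (S l).map Polynomial.C) (Sum.inl 1) (Sum.inl 0) * (∑ l, (X : ℝ[X]) ^ d l • (S l).map Polynomial.C) (Sum.inl 2) (Sum.inl 1) - (∑ l, (X : ℝ[X]) ^ d l • (S l).map Polynomial.C) (Sum.inl 0) (Sum.inl 2) * (∑ l, (X : ℝ[X]) ^ d l • (S l).map Polynomial.C) (Sum.inl 1) (Sum.inl 1) * (∑ l, (X : ℝ[X]) ^ d l • (S l).map Polynomial.C) (Sum.inl 2) (Sum.inl 0)))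
        + Polynomial.aeval (MvPolynomial.X 0 : MvPolynomial (Fin 2) ℝ) (∑ l, (X : ℝ[X]) ^ d l • (S l).map Polynomial.C).det := by
  rw [AlgHom.map_det, AlgHom.mapMatrix_apply, det_four_zero, det_four_zero, ← OsculationTwoK.map_aevalX0_pencil_gen d S]
  simp only [Matrix.add_apply, Matrix.smul_apply, Matrix.map_apply, Matrix.fromBlocks_apply₁₁, Matrix.one_apply_eq,
    Matrix.one_apply_ne (show (0 : Fin 4) ≠ 1 by decide), Matrix.one_apply_ne (show (0 : Fin 4) ≠ 2 by decide), Matrix.one_apply_ne (show (0 : Fin 4) ≠ 3 by decide),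
    Matrix.one_apply_ne (show (1 : Fin 4) ≠ 0 by decide), Matrix.one_apply_ne (show (1 : Fin 4) ≠ 2 by decide), Matrix.one_apply_ne (show (1 : Fin 4) ≠ 3 by decide),
    Matrix.one_apply_ne (show (2 : Fin 4) ≠ 0 by decide), Matrix.one_apply_ne (show (2 : Fin 4) ≠ 1 by decide), Matrix.one_apply_ne (show (2 : Fin 4) ≠ 3 by decide),
    Matrix.one_apply_ne (show (3 : Fin 4) ≠ 0 by decide), Matrix.one_apply_ne (show (3 : Fin 4) ≠ 1 by decide), Matrix.one_apply_ne (show (3 : Fin 4) ≠ 2 by decide),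
    smul_eq_mul, map_zero, map_one, mul_one, mul_zero, add_zero, map_add, map_sub, map_mul]
  ring

end OsculationCensus

end Summit.ValiantsHypothesis.ValiantsHypothesis.Theorems.LacunarySymmetroidMatrixDescartes
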